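import Summits.BirchSwinnertonDyer.BirchSwinnertonDyer.Theorems.PrintCFramBottomClassIndexLawFiveLeLevelDictionaryBetaPartner
import Literature.NumberTheory.LFunctions.GeneralizedBernoulliOneOddNonvanishingAnyField
import HarnessLib

/-!
# Route `PrintCFram`, crux C2 `BottomClassIndexLawFiveLe` (stmt-BirchSwinnertonDyer-20372), line
# `eisenstein-resource-bdp-line` (registry v19): **THE (β) CONSUMERS WITHOUT THE SIDE CONDITION `B_{1,ψ̃⁻¹} ≠ 0`**
# (cell `bsd-print-cfram`, width seat `bsd-line-cfram-p1-w4` g9; helper `--supports` 20372; 0 defs, 0 facts, 0 sorry)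

HONEST FRAMING. Nothing about BSD is proved here, and nothing of any stub. The (β) half of the LEVEL DICTIONARY
(«class factor non-unit ⟹ `Ш(W)[p] ≠ 0` ∨ level `n_W ≥ 1`, up to the `p`-isogenous partner»; w5 g3
`LevelDictionaryBeta.sha_or_levelPos_or_transverse_of_classFactor` p674651, `…_or_partner_…` p675237, and the rank-zero
twins) carries, next to Mazur–Wiles Thm. 2 (`hMW`) and the non-unit class factor `‖B_{1,ψ̃⁻¹}‖_p ≤ p⁻¹`, the hypothesis
`hB0 : bernoulliOnePrim ψ⁻¹ ≠ 0`. That hypothesis is a THEOREM: `ψ` is ODD, and `B_{1,χ} ≠ 0` for every odd primitive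
Dirichlet character (Washington Cor. 4.4 — functional equation + Dirichlet's `L(1,χ̄) ≠ 0`), transferred from `ℂ` to
`ℚ_p`-valued characters in `Literature.NumberTheory.LFunctions.bernoulliOnePrim_inv_ne_zero_of_odd` (this seat,
`GeneralizedBernoulliOneOddNonvanishingAnyField`). This file restates the four (β) consumers with `hB0` DISCHARGED, so the
LEAD's reading «B1 ⟺ B1-level ∧ B1-sha» is conditional on Mazur–Wiles Thm. 2 (+ Cassels) ONLY.

* `sha_or_levelPos_or_transverse_of_classFactor_noB0` — (β) on the class: Ш ∨ level ∨ transverse.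
* `sha_or_levelPos_or_partner_of_classFactor_noB0` — (β) on every member, transverse case moved to the partner.
* `sha_or_transverse_of_classFactor_of_finite_noB0`, `sha_or_transverse_of_classFactor_of_analyticRank_eq_zero_noB0` —
  the rank-zero twins; `sha_or_partner_sha_of_classFactor_of_finite_noB0` — the rank-zero form closed over the partner.

THEOREMS ONLY; no definition, no named fact, no `sorry`. BSD is not proved by any of this; no summit statement is
proved by this seat. References: [MazurWiles1984] Thm. 2; [Washington1997] Cor. 4.4; the LEAD g10 report §2(d), §4 and
LEAD g11 STATUS 2026-08-28T22:37:40Z («B1 in the crux's own binders»).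
-/

set_option autoImplicit false
-- `…BirchSwinnertonDyer.BirchSwinnertonDyer.Theorems…` is the problem's mandated namespace (D-0017).
set_option linter.dupNamespace false

open scoped Classical Pointwise

namespace Summit.BirchSwinnertonDyer.BirchSwinnertonDyer.Theorems.PrintCFram.LevelDictionaryBeta

open NumberField IsDedekindDomain Field WeierstrassCurve DirichletCharacter
open Literature.NumberTheory.EllipticCurves Literature.NumberTheory.GaloisRepresentations
  Literature.NumberTheory.EllipticCurves.KrizLi2019 Literature.NumberTheory.NumberFields
  Literature.NumberTheory.EllipticCurves.GreenbergSelmer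
open Literature.NumberTheory.EllipticCurves.Rank1Residual (CMRamified)
open Summit.BirchSwinnertonDyer.Rank1Residual
open Literature.NumberTheory.LFunctions (bernoulliOnePrim_inv_ne_zero_of_odd)

variable {p : ℕ} [hp : Fact p.Prime]

variable (W : WeierstrassCurve ℚ) [W.IsElliptic] [W.IsGloballyMinimal]

/-- **(β) ON THE CLASS, `hB0`-FREE: CLASS FACTOR NON-UNIT ⟹ `Ш(W)[p] ≠ 0` ∨ LEVEL `n ≥ 1` ∨ TRANSVERSE.**
w5 g3's `sha_or_levelPos_or_transverse_of_classFactor` with the hypothesis `bernoulliOnePrim ψ⁻¹ ≠ 0` discharged by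
`bernoulliOnePrim_inv_ne_zero_of_odd` (`ψ` is odd). Conditional on Mazur–Wiles Thm. 2 (`hMW`) only.
[cite: MazurWiles1984, Thm. 2 (p. 216)] [cite: Washington1997, Cor. 4.4] -/
theorem sha_or_levelPos_or_transverse_of_classFactor_noB0
    (hMW : MazurWiles1984.thm2_card_oddChiClassGroup_eq_bernoulli)
    (hCM : W.HasCM) (hram : CMRamified W p) (h5 : 5 ≤ p)
    {f : ℕ} [NeZero f] (ψ : DirichletCharacter ℚ_[p] f) (ω : DirichletCharacter ℚ_[p] p)
    (hψ : ψ.Odd) (hω : IsTeichmullerCharacter ω)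
    (hss : ∀ ℓ : ℕ, ℓ.Prime → ¬ (ℓ ∣ p * W.conductorNorm ℤ) →
      ‖((W.LFunction ℓ : ℤ) : ℚ_[p]) - (ψ (ℓ : ZMod f) + ψ⁻¹ (ℓ : ZMod f) * ω (ℓ : ZMod p))‖ < 1)
    (hB : ‖bernoulliOnePrim ψ⁻¹‖ ≤ (p : ℝ)⁻¹)
    {g : W.toAffine.Point}
    (hgen : ∀ R : W.toAffine.Point, ∃ (k : ℤ) (T : W.toAffine.Point), IsOfFinAddOrder T ∧ R = k • g + T) :
    (∃ c ∈ W.sha, c ≠ 0 ∧ p • c = 0) ∨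
      (∃ Q : (W.baseChange ℚ_[p]).toAffine.Point, p • Q = W.toPadicPoint p g) ∨
      ∃ (Φ : X2.ResidualDevissageModules.StableSubgroup (absoluteGaloisGroup ℚ) (W.geomTorsion (p : ℤ)))
        (w : contOneCocycles (discreteTopRep (absoluteGaloisGroup ℚ) Φ.Quot)),
        Nat.card Φ.Sub = p ∧ oneCocycleClass _ w ≠ 0 ∧
        ∀ (v : HeightOneSpectrum (𝓞 ℚ)) (𝔓 : Ideal (absIntegers (𝓞 ℚ) ℚ)), 𝔓 ∈ v.primesAbove →
          ∃ y : Φ.Quot, ∀ γ ∈ 𝔓.inertia (absoluteGaloisGroup ℚ), w.1 γ = γ • y - y :=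
  sha_or_levelPos_or_transverse_of_classFactor W hMW hCM hram h5 ψ ω hψ hω hss
    (bernoulliOnePrim_inv_ne_zero_of_odd ψ hψ) hB hgen

/-- **(β) ON EVERY CLASS MEMBER, `hB0`-FREE: CLASS FACTOR NON-UNIT ⟹ (`Ш(W)[p] ≠ 0` ∨ `n_W ≥ 1`) OR THE SAME FOR
THE `p`-ISOGENOUS PARTNER.** w5 g3's `sha_or_levelPos_or_partner_of_classFactor` (p675237) with `hB0` discharged by
`bernoulliOnePrim_inv_ne_zero_of_odd`. Conditional on Mazur–Wiles Thm. 2 (`hMW`) only — the form the LEAD's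
«B1 ⟺ B1-level ∧ B1-sha» END STATE consumes. [cite: MazurWiles1984, Thm. 2 (p. 216)] [cite: Washington1997, Cor. 4.4] -/
theorem sha_or_levelPos_or_partner_of_classFactor_noB0
    (hMW : MazurWiles1984.thm2_card_oddChiClassGroup_eq_bernoulli)
    (hCM : W.HasCM) (hram : CMRamified W p) (h5 : 5 ≤ p)
    {f : ℕ} [NeZero f] (ψ : DirichletCharacter ℚ_[p] f) (ω : DirichletCharacter ℚ_[p] p)
    (hψ : ψ.Odd) (hω : IsTeichmullerCharacter ω)
    (hss : ∀ ℓ : ℕ, ℓ.Prime → ¬ (ℓ ∣ p * W.conductorNorm ℤ) →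
      ‖((W.LFunction ℓ : ℤ) : ℚ_[p]) - (ψ (ℓ : ZMod f) + ψ⁻¹ (ℓ : ZMod f) * ω (ℓ : ZMod p))‖ < 1)
    (hB : ‖bernoulliOnePrim ψ⁻¹‖ ≤ (p : ℝ)⁻¹)
    {g : W.toAffine.Point}
    (hgen : ∀ R : W.toAffine.Point, ∃ (k : ℤ) (T : W.toAffine.Point), IsOfFinAddOrder T ∧ R = k • g + T) :
    ((∃ c ∈ W.sha, c ≠ 0 ∧ p • c = 0) ∨
      ∃ Q : (W.baseChange ℚ_[p]).toAffine.Point, p • Q = W.toPadicPoint p g) ∨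
    ∃ (W₁ : WeierstrassCurve ℚ) (_ : W₁.IsElliptic) (_ : W₁.IsGloballyMinimal),
      W₁.HasCM ∧ CMRamified W₁ p ∧ (∃ φ : Isogeny W W₁, φ.degree = p) ∧
      ∀ g₁ : W₁.toAffine.Point,
        (∀ R : W₁.toAffine.Point, ∃ (k : ℤ) (T : W₁.toAffine.Point), IsOfFinAddOrder T ∧ R = k • g₁ + T) →
        (∃ c ∈ W₁.sha, c ≠ 0 ∧ p • c = 0) ∨
          ∃ Q : (W₁.baseChange ℚ_[p]).toAffine.Point, p • Q = W₁.toPadicPoint p g₁ :=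
  sha_or_levelPos_or_partner_of_classFactor W hMW hCM hram h5 ψ ω hψ hω hss
    (bernoulliOnePrim_inv_ne_zero_of_odd ψ hψ) hB hgen

/-- **(β) RANK-ZERO TWIN, `hB0`-FREE: CLASS FACTOR NON-UNIT ⟹ `Ш(W)[p] ≠ 0` ∨ TRANSVERSE** for `W(ℚ)` finite.
w5 g3's `sha_or_transverse_of_classFactor_of_finite` with `hB0` discharged by `bernoulliOnePrim_inv_ne_zero_of_odd`.
[cite: MazurWiles1984, Thm. 2 (p. 216)] [cite: Washington1997, Cor. 4.4] -/
theorem sha_or_transverse_of_classFactor_of_finite_noB0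
    (hMW : MazurWiles1984.thm2_card_oddChiClassGroup_eq_bernoulli)
    (hCM : W.HasCM) (hram : CMRamified W p) (h5 : 5 ≤ p) (hfin : Finite W.toAffine.Point)
    {f : ℕ} [NeZero f] (ψ : DirichletCharacter ℚ_[p] f) (ω : DirichletCharacter ℚ_[p] p)
    (hψ : ψ.Odd) (hω : IsTeichmullerCharacter ω)
    (hss : ∀ ℓ : ℕ, ℓ.Prime → ¬ (ℓ ∣ p * W.conductorNorm ℤ) →
      ‖((W.LFunction ℓ : ℤ) : ℚ_[p]) - (ψ (ℓ : ZMod f) + ψ⁻¹ (ℓ : ZMod f) * ω (ℓ : ZMod p))‖ < 1)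
    (hB : ‖bernoulliOnePrim ψ⁻¹‖ ≤ (p : ℝ)⁻¹) :
    (∃ c ∈ W.sha, c ≠ 0 ∧ p • c = 0) ∨
      ∃ (Φ : X2.ResidualDevissageModules.StableSubgroup (absoluteGaloisGroup ℚ) (W.geomTorsion (p : ℤ)))
        (w : contOneCocycles (discreteTopRep (absoluteGaloisGroup ℚ) Φ.Quot)),
        Nat.card Φ.Sub = p ∧ oneCocycleClass _ w ≠ 0 ∧
        ∀ (v : HeightOneSpectrum (𝓞 ℚ)) (𝔓 : Ideal (absIntegers (𝓞 ℚ) ℚ)), 𝔓 ∈ v.primesAbove →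
          ∃ y : Φ.Quot, ∀ γ ∈ 𝔓.inertia (absoluteGaloisGroup ℚ), w.1 γ = γ • y - y :=
  sha_or_transverse_of_classFactor_of_finite W hMW hCM hram h5 hfin ψ ω hψ hω hss
    (bernoulliOnePrim_inv_ne_zero_of_odd ψ hψ) hB

/-- **(β) RANK-ZERO TWIN FROM `r_an(W) = 0` (granted GZK), `hB0`-FREE.** w5 g3's
`sha_or_transverse_of_classFactor_of_analyticRank_eq_zero` with `hB0` discharged by
`bernoulliOnePrim_inv_ne_zero_of_odd`. [cite: MazurWiles1984, Thm. 2 (p. 216)] [cite: Washington1997, Cor. 4.4]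
[cite: GrossZagier1986, Thm. I.(6.3)] -/
theorem sha_or_transverse_of_classFactor_of_analyticRank_eq_zero_noB0
    (hGZK : rank_eq_analyticRank_of_analyticRank_le_one)
    (hMW : MazurWiles1984.thm2_card_oddChiClassGroup_eq_bernoulli)
    (hCM : W.HasCM) (hram : CMRamified W p) (h5 : 5 ≤ p) (hr : W.analyticRank = 0)
    {f : ℕ} [NeZero f] (ψ : DirichletCharacter ℚ_[p] f) (ω : DirichletCharacter ℚ_[p] p)
    (hψ : ψ.Odd) (hω : IsTeichmullerCharacter ω)
    (hss : ∀ ℓ : ℕ, ℓ.Prime → ¬ (ℓ ∣ p * W.conductorNorm ℤ) →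
      ‖((W.LFunction ℓ : ℤ) : ℚ_[p]) - (ψ (ℓ : ZMod f) + ψ⁻¹ (ℓ : ZMod f) * ω (ℓ : ZMod p))‖ < 1)
    (hB : ‖bernoulliOnePrim ψ⁻¹‖ ≤ (p : ℝ)⁻¹) :
    (∃ c ∈ W.sha, c ≠ 0 ∧ p • c = 0) ∨
      ∃ (Φ : X2.ResidualDevissageModules.StableSubgroup (absoluteGaloisGroup ℚ) (W.geomTorsion (p : ℤ)))
        (w : contOneCocycles (discreteTopRep (absoluteGaloisGroup ℚ) Φ.Quot)),
        Nat.card Φ.Sub = p ∧ oneCocycleClass _ w ≠ 0 ∧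
        ∀ (v : HeightOneSpectrum (𝓞 ℚ)) (𝔓 : Ideal (absIntegers (𝓞 ℚ) ℚ)), 𝔓 ∈ v.primesAbove →
          ∃ y : Φ.Quot, ∀ γ ∈ 𝔓.inertia (absoluteGaloisGroup ℚ), w.1 γ = γ • y - y :=
  sha_or_transverse_of_classFactor_of_analyticRank_eq_zero W hGZK hMW hCM hram h5 hr ψ ω hψ hω hss
    (bernoulliOnePrim_inv_ne_zero_of_odd ψ hψ) hB

/-- **(β) RANK-ZERO FORM ON EVERY CLASS MEMBER, `hB0`-FREE: CLASS FACTOR NON-UNIT ⟹ `Ш(W)[p] ≠ 0` OR `Ш(W₁)[p] ≠ 0`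
FOR THE `p`-ISOGENOUS PARTNER.** w5 g3's `sha_or_partner_sha_of_classFactor_of_finite` (p675860) with `hB0` discharged
by `bernoulliOnePrim_inv_ne_zero_of_odd`: an Eisenstein-IRREGULAR RANK-ZERO member's rational `p`-isogeny class
carries non-trivial `Ш[p]`, conditional on Mazur–Wiles Thm. 2 ONLY. [cite: MazurWiles1984, Thm. 2 (p. 216)]
[cite: Washington1997, Cor. 4.4] -/
theorem sha_or_partner_sha_of_classFactor_of_finite_noB0
    (hMW : MazurWiles1984.thm2_card_oddChiClassGroup_eq_bernoulli)
    (hCM : W.HasCM) (hram : CMRamified W p) (h5 : 5 ≤ p) (hfin : Finite W.toAffine.Point)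
    {f : ℕ} [NeZero f] (ψ : DirichletCharacter ℚ_[p] f) (ω : DirichletCharacter ℚ_[p] p)
    (hψ : ψ.Odd) (hω : IsTeichmullerCharacter ω)
    (hss : ∀ ℓ : ℕ, ℓ.Prime → ¬ (ℓ ∣ p * W.conductorNorm ℤ) →
      ‖((W.LFunction ℓ : ℤ) : ℚ_[p]) - (ψ (ℓ : ZMod f) + ψ⁻¹ (ℓ : ZMod f) * ω (ℓ : ZMod p))‖ < 1)
    (hB : ‖bernoulliOnePrim ψ⁻¹‖ ≤ (p : ℝ)⁻¹) :
    (∃ c ∈ W.sha, c ≠ 0 ∧ p • c = 0) ∨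
    ∃ (W₁ : WeierstrassCurve ℚ) (_ : W₁.IsElliptic) (_ : W₁.IsGloballyMinimal),
      W₁.HasCM ∧ CMRamified W₁ p ∧ (∃ φ : Isogeny W W₁, φ.degree = p) ∧ Finite W₁.toAffine.Point ∧
      ∃ c ∈ W₁.sha, c ≠ 0 ∧ p • c = 0 :=
  sha_or_partner_sha_of_classFactor_of_finite W hMW hCM hram h5 hfin ψ ω hψ hω hss
    (bernoulliOnePrim_inv_ne_zero_of_odd ψ hψ) hB

end Summit.BirchSwinnertonDyer.BirchSwinnertonDyer.Theorems.PrintCFram.LevelDictionaryBeta
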